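import Summits.ResolutionOfSingularities.ResolutionOfSingularities.Theorems.TowerCutStage

/-!
# TowerCut — the spread-curve exit `SpreadExit`, proved on its landed letter

`decomp-res-lens-2`, generation 29 (RESIDUAL MODE node; lens «structural dichotomy, special vs generic»;
critic rows 219 / 220a).  Host route `MaxContactCut`, item `MaxContactCut.RungOne`
(`stmt-ResolutionOfSingularities-29273`), wired BY NAME through the landed
`CuspX.closes : CuspGenericRung → CuspSpecialRung → RungOne` and
`PortCut.cuspGenericRung_of_engines` (18 engine binders, among them `(hΓE : SpreadExit)`).

## Main results

* `spreadExit_holds : SpreadExit` — the engine `SpreadCut.SpreadExit` (`Theorems/SpreadCutLaw3.lean`),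
  VERBATIM and hypothesis-free: for a regular `Y`, an ideal sheaf `I`, `2 ≤ n` and a uniform spread curve
  `η` (a curve point, `IsSpreadAt I n m η y` at every closed `y ⤳ η`), the package `⟨I, [], n⟩` exits over
  `{y | η ⤳ y}` (`PackageExitsOver`): a weakly admissible centre sequence over the curve whose last
  transform has `2 ≤ τ` wherever the order is still `n`.
* `cuspGenericRung_of_engines` — the landed 18-binder discharge `PortCut.cuspGenericRung_of_engines` with
  `hΓE` discharged by `spreadExit_holds` (17 engine binders left); `closes_of_engines` displays
  `MaxContactCut.RungOne` from the 17 engines and `CuspX.CuspSpecialRung` via `CuspX.closes` (by name,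
  nothing re-landed).

## The mechanism (a tower of surface centres)

Write `m + 1 = (q + 1) n` (`1 ≤ q`).  Stage 0 blows up the curve `C₀ = V(𝓘_{closure {η}})` (regular:
`isRegular_curve_subscheme`, from the `RelSimple` frames; `supp C₀ ⊆ supp (I, n)` from `I_y ≤ Q(mn) ≤ P^n`
and localisation at `η`).  Above every point of the curve the controlled transform `I₁` then carries, at
EVERY point `x'` of the exceptional divisor (closed or not), either `I₁ = ⊤` or SHAPE DATA
(`ShapeData (I₁)_{x'} (𝓔)_{x'} n (m - n)`): a frame `z, u, φ` with `(z, u)` part of a regular system of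
parameters, `𝓔 = (u)`, a member `zⁿ + uᵃ φ + g` with `g ∈ Q(z,u; a,n)(na+1)`, `I₁ ≤ Q(na)`, and the
SIMPLE-POINT clause `φ ∈ 𝔪 → (z, u, φ)` part of an r.s.o.p. (`towerInv_of_isSpreadAt` over closed
points via the chart laws `spread_zChart` / `spread_uChart`; over `η` by properness of the blow-up,
`exists_specializes_over`, and generisation `inv_of_specializes` = `ShapeData.nonempty_mapOfLePrime` +
`ShapeData.map_eq_top_of_not_mem`).  The Σ-STAGE ENGINE `sigmaStage` then runs `q - 1` further blow-ups
in the regular surface centres `Σ_j = V(√(I_j + 𝓔_j)) = V(z, u)` (`isRegular_radical_sup_subscheme`,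
`support_radical_sup_subset(_T)`), each lowering the weight `a` by `n` (`stageInv_blowup` =
`ShapeData.zChart` / `ShapeData.uChart`), until `a + 1 = n`; there `ShapeData.exists_two_le_hironakaTauAt`
(`φ ∈ 𝔪` by quasi-regularity, `pow_not_mem_pow_succ_of_rsop`; then the initial form `Zⁿ + Uᵃ Φ + U H̄`
has `τ ≥ 2`, `two_le_hironakaTau_exitForm`) gives the exit clause `2 ≤ tauAt`.

Sections: §Q weighted ideals `qWeighted` (membership, degree bounds, maps, chart law, colon) · §S the
`Type`-valued proof device `ShapeData` and its algebra · §E exit (`τ ≥ 2` at the last stage) · §C the two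
blow-up charts of a Σ-stage · §5/§7 the stage-0 algebra and charts (`RelSimple` ⇒ r.s.o.p. at every prime,
`isRsopPart_of_relSimple`) · §6 the Σ-stage engine · §8 the tower and `spreadExit_holds` · §9 corollaries.

All statements are over the tree's landed definitions (`SpreadCut`, `RelativeDeltaCut.PackageExitsOver`,
`DeltaFaceCutClasses.qWeighted/binForm/lowerChart/upperChart/RelSimple`, `CentreSeq`, `WeakAdmissible`,
`tauAt`, Literature blow-up charts `exists_reesChart_stalk`, `IsRsopPart`, `hironakaTauAt`); no new
`Prop`-valued definition, no notation, no instance.  Sources: [Hironaka1964] (τ and the directrix),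
[CossartJannsenSaito2020] (permissible blow-ups, order along regular centres), [CutkoskyBook2004] §7
(embedded resolution of surfaces: towers over curves of maximal contact) — folklore chart computations.
-/

open CategoryTheory AlgebraicGeometry IsLocalRing TopologicalSpace Topology
open Literature.AlgebraicGeometry.Resolution
open Summit.ResolutionOfSingularities.ResolutionOfSingularities.Theorems
open Summit.ResolutionOfSingularities.ResolutionOfSingularities.Theorems.WeakOrderReduction
open Summit.ResolutionOfSingularities.ResolutionOfSingularities.Theorems.DeltaFaceCutClasses
open Summit.ResolutionOfSingularities.ResolutionOfSingularities.Theorems.RelativeDeltaCut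
open Summit.ResolutionOfSingularities.ResolutionOfSingularities.Theorems.SpreadCut

namespace Summit.ResolutionOfSingularities.ResolutionOfSingularities.Theorems.TowerCut

/-! ## §8  THE TOWER (scheme level): blow up the curve `C₀ = cl{η}` first; the stage invariant with `a = m - n`
holds at every point of `Y₁` over `cl{η}` (chart laws at the closed points, generisation transport at the points over
`η`, reached through a specialisation over a closed point of the curve by properness of the blow-up); then the
Σ-stage engine runs `q - 1` times.  This proves the engine letter `SpreadExit` with no hypothesis. -/

section Tower

/-- **Localising a shape away from `z`**: if `z ∉ 𝔮 ∋ u` then `J·A_𝔮 = (1)` (the shape element is `zⁿ·(unit)`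
modulo `(u)`). [folklore] -/
theorem ShapeData.map_eq_top_of_not_mem {A : Type} [CommRing A] [IsLocalRing A] {J E : Ideal A} {n a : ℕ}
    (D : ShapeData J E n a) (ha : 1 ≤ a) (q : Ideal A) [q.IsPrime] (hz : D.z ∉ q) (hu : D.u ∈ q)
    (Aq : Type) [CommRing Aq] [Algebra A Aq] [IsLocalization.AtPrime Aq q] :
    J.map (algebraMap A Aq) = ⊤ := by
  have hg : D.g ∈ Ideal.span {D.z ^ (n + 1)} ⊔ Ideal.span {D.u} := qWeighted_succ_le_sup D.z D.u a n D.tail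
  obtain ⟨g₁, hg₁, g₂, hg₂, hgs⟩ := Submodule.mem_sup.mp hg
  obtain ⟨r, rfl⟩ := Ideal.mem_span_singleton'.mp hg₁
  obtain ⟨s, rfl⟩ := Ideal.mem_span_singleton'.mp hg₂
  have hF : D.z ^ n + D.u ^ a * D.φ + D.g ∉ q := by
    intro hF
    obtain ⟨a', rfl⟩ : ∃ a', a = a' + 1 := ⟨a - 1, by omega⟩
    have h1 : D.z ^ n * (1 + D.z * r) ∈ q := by
      have : D.z ^ n * (1 + D.z * r) =
          (D.z ^ n + D.u ^ (a' + 1) * D.φ + D.g) - D.u * (D.u ^ a' * D.φ + s) := by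
        rw [← hgs]; ring
      rw [this]
      exact q.sub_mem hF (q.mul_mem_right _ hu)
    rcases ‹q.IsPrime›.mem_or_mem h1 with h | h
    · exact hz (‹q.IsPrime›.mem_of_pow_mem n h)
    · exact ‹q.IsPrime›.ne_top (Ideal.eq_top_of_isUnit_mem _ h
        (isUnit_add_of_mem isUnit_one (Ideal.mul_mem_right _ _ D.z_mem)))
  exact Ideal.eq_top_of_isUnit_mem _ (Ideal.mem_map_of_mem _ D.mem)
    (IsLocalization.map_units Aq (⟨_, hF⟩ : q.primeCompl))

variable {Y : Scheme.{0}}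

/-- **Generisation transport of the stage invariant**: for `x' ⤳ x''` with `x'` on `supp 𝓔`, the invariant at `x''`
gives the invariant at `x'` (`𝒪_{x'}` is the localisation of `𝒪_{x''}` at a prime `𝔮 ∋ u`; if `z ∈ 𝔮` the shape
localises, if `z ∉ 𝔮` then `𝓘_{x'} = (1)`). [folklore] -/
theorem inv_of_specializes (J Ex : Y.IdealSheafData) {n a : ℕ} (ha : 1 ≤ a) {x' x'' : Y} (h : x' ⤳ x'')
    (hx' : x' ∈ (Ex.support : Set Y))
    (hinv : stalkIdeal J x'' = ⊤ ∨ Nonempty (ShapeData (stalkIdeal J x'') (stalkIdeal Ex x'') n a)) :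
    stalkIdeal J x' = ⊤ ∨ Nonempty (ShapeData (stalkIdeal J x') (stalkIdeal Ex x') n a) := by
  letI := (Y.presheaf.stalkSpecializes h).hom.toAlgebra
  haveI := isLocalizationAtPrime_stalkSpecializes h
  have halg : algebraMap (Y.presheaf.stalk x'') (Y.presheaf.stalk x') = (Y.presheaf.stalkSpecializes h).hom :=
    RingHom.algebraMap_toAlgebra _
  have hJ : stalkIdeal J x' = (stalkIdeal J x'').map (algebraMap _ _) := by
    rw [halg, stalkIdeal_map_stalkSpecializes]
  have hE : stalkIdeal Ex x' = (stalkIdeal Ex x'').map (algebraMap _ _) := by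
    rw [halg, stalkIdeal_map_stalkSpecializes]
  rcases hinv with htop | ⟨⟨D⟩⟩
  · left
    rw [hJ, htop, Ideal.map_top]
  · have hEx' : stalkIdeal Ex x' ≤ maximalIdeal _ := (mem_support_iff_stalkIdeal_le Ex x').mp hx'
    have hu : D.u ∈ (maximalIdeal (Y.presheaf.stalk x')).comap (Y.presheaf.stalkSpecializes h).hom := by
      rw [Ideal.mem_comap, ← halg]
      refine hEx' ?_
      rw [hE]
      exact Ideal.mem_map_of_mem _ D.u_mem_exc
    by_cases hz : D.z ∈ (maximalIdeal (Y.presheaf.stalk x')).comap (Y.presheaf.stalkSpecializes h).hom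
    · right
      rw [hJ, hE]
      exact D.nonempty_mapOfLePrime _ hz hu (Y.presheaf.stalk x')
    · left
      rw [hJ]
      exact D.map_eq_top_of_not_mem ha _ hz hu (Y.presheaf.stalk x')

/-- **Specialising over a prescribed point** for a closed map `π`: if `π x' ⤳ y₀` then some `x'' ∈ cl{x'}` maps to
`y₀` (`π(cl{x'})` is closed and contains `π x'`). [folklore] -/
theorem exists_specializes_over {Z : Scheme.{0}} (π : Z ⟶ Y) (hπ : IsClosedMap π) (x' : Z) {y₀ : Y}
    (hy₀ : π x' ⤳ y₀) : ∃ x'' : Z, x' ⤳ x'' ∧ π x'' = y₀ := by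
  have hcl : IsClosed (π '' closure {x'}) := hπ _ isClosed_closure
  have hsub : closure {π x'} ⊆ π '' closure {x'} :=
    closure_minimal (Set.singleton_subset_iff.mpr ⟨x', subset_closure rfl, rfl⟩) hcl
  obtain ⟨x'', hx'', hπx⟩ := hsub (specializes_iff_mem_closure.mp hy₀)
  exact ⟨x'', specializes_iff_mem_closure.mpr hx'', hπx⟩

/-- **A spread-shaped closed point is δ-deep for the curve prime**: `𝓘_y ⊆ Q(mn) ⊆ 𝔓ⁿ` and `𝔓 ⊆ 𝔪`. [folklore] -/
theorem exists_stalkIdeal_le_curvePrime_pow (I : Y.IdealSheafData) {n m : ℕ} {η y : Y} (hn : 2 ≤ n)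
    (hsp : IsSpreadAt I n m η y) :
    ∃ h : η ⤳ y, stalkIdeal I y ≤ curvePrime h ^ n ∧ curvePrime h ≤ maximalIdeal (Y.presheaf.stalk y) := by
  obtain ⟨h, c, v, g, f, G, hP, hW', hd, hfJ, hJ, hf, hg, ⟨q, hq1, hq⟩, hlow, hup⟩ := hsp
  have hnm : 2 * n ≤ m + 1 := by rw [hq]; exact Nat.mul_le_mul_right n (by omega)
  refine ⟨h, ?_, ?_⟩
  · rw [← hP]
    exact hJ.trans (qWeighted_le_pow c (by omega) (by omega) (le_of_eq (Nat.mul_comm n m)))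
  · rw [← hP, ← hW']
    exact Ideal.span_mono Set.subset_union_left

/-- **The curve prime at a spread-shaped closed point is generated by part of a regular system of parameters**
(`c` extends by `v` to a minimal basis of `𝔪`). [folklore] -/
theorem isRsopPart_of_isSpreadAt [IsLocallyNoetherian Y] (hY : Scheme.IsRegular Y) (I : Y.IdealSheafData)
    {n m : ℕ} {η y : Y} (hsp : IsSpreadAt I n m η y) :
    ∃ (h : η ⤳ y) (c : Fin 3 → Y.presheaf.stalk y), Ideal.span (Set.range c) = curvePrime h ∧
      @IsRsopPart _ _ (hY y).toIsLocalRing 3 c := by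
  haveI := hY y
  obtain ⟨h, c, v, g, f, G, hP, hW', hd, -, -, -⟩ := hsp
  have hW : Ideal.span (Set.range (Fin.append c ![v])) = maximalIdeal _ := by
    rw [← hW', range_fin_append, Matrix.range_cons, Matrix.range_empty, Set.union_empty]
  refine ⟨h, c, hP, ?_⟩
  have := isRsopPart_comp_of_rsop hd (Fin.append c ![v]) hW (Fin.castAdd 1) (Fin.castAdd_injective _ _)
  convert this using 1
  funext i
  simp [Fin.append_left]

/-- **The reduced curve `cl{η}` of a uniformly spread curve is a regular scheme**: its local ring at a closed point
`y` is `𝒪_{Y,y}/(c)` with `c` part of a regular system of parameters, and at `η` it is the residue field. [folklore] -/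
theorem isRegular_curve_subscheme [IsLocallyNoetherian Y] (hY : Scheme.IsRegular Y) (I : Y.IdealSheafData)
    {n m : ℕ} {η : Y} (hcurve : IsCurvePt η)
    (hspread : ∀ y : Y, η ⤳ y → IsClosed ({y} : Set Y) → IsSpreadAt I n m η y) :
    Scheme.IsRegular
      (Scheme.IdealSheafData.vanishingIdeal (⟨closure ({η} : Set Y), isClosed_closure⟩ : Closeds Y)).subscheme := by
  refine isRegular_subscheme_vanishingIdeal_closure_of_forall fun z hz => ?_
  by_cases hzη : z = η
  · subst hzη
    exact isRegularLocalRing_stalk_quotient_primeOfSpecializes_self z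
  · haveI := hY z
    obtain ⟨h, c, hP, hc⟩ := isRsopPart_of_isSpreadAt hY I (hspread z hz (hcurve.2 z hz hzη))
    change IsRegularLocalRing (Y.presheaf.stalk z ⧸ curvePrime h)
    rw [← hP]
    exact hc.isRegularLocalRing_quotient

/-- **THE STAGE INVARIANT AFTER THE CURVE BLOW-UP, over a spread-shaped closed point** (`a = m - n`): the chart
dictionary at `x'` (`IsBlowup.exists_reesChart_stalk`) and the stage-0 chart laws — `spread_zChart` in the
`c₀`-chart, `spread_uChart` in the `c₁`-chart (binary form ↦ `tᵐ·θ(upperChart)`) and in the `c₂`-chart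
(`↦ tᵐ·θ(lowerChart)`), fed with the relative simplicity of the secondary polynomials. [folklore] -/
theorem towerInv_of_isSpreadAt [IsLocallyNoetherian Y] (hY : Scheme.IsRegular Y) (C I : Y.IdealSheafData)
    {n m : ℕ} (hn : 2 ≤ n) {η : Y} (hC : ∀ (y : Y) (h : η ⤳ y), stalkIdeal C y = curvePrime h)
    (x' : ↑(blowup C)) (hsp : IsSpreadAt I n m η (blowup.π C x')) :
    stalkIdeal (controlledTransform (blowup.π C) C I n) x' = ⊤ ∨
      Nonempty (ShapeData (stalkIdeal (controlledTransform (blowup.π C) C I n) x')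
        (stalkIdeal (C.comap (blowup.π C)) x') n (m - n)) := by
  haveI := CentreSeq.isLocallyNoetherian_blowup C
  haveI := hY (blowup.π C x')
  obtain ⟨h, c, v, g, f, G, hP, hW', hd, hfJ, hJ, hf, hg, ⟨q, hq1, hq⟩, hlow, hup⟩ := hsp
  have hc : Ideal.span (Set.range c) = stalkIdeal C (blowup.π C x') := by rw [hC _ h, hP]
  obtain ⟨j, 𝔴, χ, hχ, hloc, h𝔴⟩ := (blowup.isBlowup C).exists_reesChart_stalk x' c hc
  have hu : ∀ l, ((blowup.π C).stalkMap x').hom (c l) =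
      ((blowup.π C).stalkMap x').hom (c j) * χ (chartGen c j l) :=
    fun l => by rw [← hχ, ← hχ, ← map_mul, ← reesChartBase_apply_eq_mul_chartGen _ j l]
  have hCmap : (stalkIdeal C (blowup.π C x')).map ((blowup.π C).stalkMap x').hom =
      Ideal.span {((blowup.π C).stalkMap x').hom (c j)} := by
    rw [← hc, Ideal.map_span_range_eq_span_singleton _ _ j _ hu]
  have hJ' : stalkIdeal (controlledTransform (blowup.π C) C I n) x' =
      Submodule.colon ((stalkIdeal I (blowup.π C x')).map ((blowup.π C).stalkMap x').hom)
        ((Ideal.span {((blowup.π C).stalkMap x').hom (c j)} ^ n : Ideal _) : Set _) := by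
    rw [controlledTransform, stalkIdeal_colon, stalkIdeal_pow, stalkIdeal_comap_eq_map_stalkMap,
      stalkIdeal_comap_eq_map_stalkMap, hCmap]
  have hE' : stalkIdeal (C.comap (blowup.π C)) x' = Ideal.span {((blowup.π C).stalkMap x').hom (c j)} := by
    rw [stalkIdeal_comap_eq_map_stalkMap, hCmap]
  rw [hJ', hE']
  have hW : Ideal.span (Set.range (Fin.append c ![v])) = maximalIdeal _ := by
    rw [← hW', range_fin_append, Matrix.range_cons, Matrix.range_empty, Set.union_empty]
  have hd' : (maximalIdeal (Y.presheaf.stalk (blowup.π C x'))).spanFinrank = 3 + 1 := hd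
  have hnm : 2 * n ≤ m + 1 := by rw [hq]; exact Nat.mul_le_mul_right n (by omega)
  rw [← hP] at hlow hup
  obtain rfl | rfl | rfl : j = 0 ∨ j = 1 ∨ j = 2 := by fin_cases j <;> simp
  · exact Or.inl (spread_zChart c v g f G hW hn hnm hfJ hf hg 𝔴 χ hloc h𝔴 _ hχ)
  · have hθC : ∀ a, (χ.comp (Polynomial.eval₂RingHom (chartBase c 1) (chartGen c 1 2))) (Polynomial.C a) =
        ((blowup.π C).stalkMap x').hom a := fun a => by
      rw [RingHom.comp_apply, Polynomial.coe_eval₂RingHom, Polynomial.eval₂_C]; exact hχ a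
    have h2 : ((blowup.π C).stalkMap x').hom (c 2) = ((blowup.π C).stalkMap x').hom (c 1) *
        (χ.comp (Polynomial.eval₂RingHom (chartBase c 1) (chartGen c 1 2))) Polynomial.X := by
      rw [RingHom.comp_apply, Polynomial.coe_eval₂RingHom, Polynomial.eval₂_X]; exact hu 2
    have hb := map_binForm_eq_upper _ _ hθC (c 1) (c 2) _ rfl h2 G m
    rw [RingHom.comp_apply] at hb
    exact spread_uChart c v g f G 1 2 (by decide) (by decide) (by decide) hW hd' hn hnm hfJ hf hg hJ
      (upperChart G m) hup 𝔴 χ hloc h𝔴 _ hχ hb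
  · have hθC : ∀ a, (χ.comp (Polynomial.eval₂RingHom (chartBase c 2) (chartGen c 2 1))) (Polynomial.C a) =
        ((blowup.π C).stalkMap x').hom a := fun a => by
      rw [RingHom.comp_apply, Polynomial.coe_eval₂RingHom, Polynomial.eval₂_C]; exact hχ a
    have h1 : ((blowup.π C).stalkMap x').hom (c 1) = ((blowup.π C).stalkMap x').hom (c 2) *
        (χ.comp (Polynomial.eval₂RingHom (chartBase c 2) (chartGen c 2 1))) Polynomial.X := by
      rw [RingHom.comp_apply, Polynomial.coe_eval₂RingHom, Polynomial.eval₂_X]; exact hu 1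
    have hb := map_binForm_eq_lower _ _ hθC (c 1) (c 2) _ h1 rfl G m
    rw [RingHom.comp_apply] at hb
    exact spread_uChart c v g f G 2 1 (by decide) (by decide) (by decide) hW hd' hn hnm hfJ hf hg hJ
      (lowerChart G m) hlow 𝔴 χ hloc h𝔴 _ hχ hb

/-- **ENGINE (Γ) `SpreadExit` — PROVED.**  On a regular scheme, a uniformly spread-shaped curve `cl{η}` of order
`n ≥ 2` and degree `m` (`m + 1 = (q + 1) n`) has an exit package with centres over it: the curve blow-up followed by
the `q - 1` surface blow-ups of the Σ-stage engine; every centre is regular and inside `supp(𝓘, n)`, and at every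
point of order `n` over the curve after the tower Hironaka's `τ ≥ 2`. [folklore] -/
theorem spreadExit_holds : SpreadExit := by
  intro Y hY I n hn m η hU hLN
  obtain ⟨hcurve, hspread⟩ := hU
  haveI : IsLocallyNoetherian Y := hLN
  -- a closed point of the curve
  obtain ⟨y₀, hy₀, hy₀η⟩ : ∃ y₀ : Y, η ⤳ y₀ ∧ y₀ ≠ η := by
    by_contra hcon
    push Not at hcon
    refine hcurve.1 ?_
    have hcl : closure ({η} : Set Y) = {η} := by
      refine Set.Subset.antisymm (fun y hy => ?_) subset_closure
      exact hcon y (specializes_iff_mem_closure.mpr hy)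
    rw [← hcl]
    exact isClosed_closure
  have hy₀c : IsClosed ({y₀} : Set Y) := hcurve.2 y₀ hy₀ hy₀η
  -- the degree bookkeeping `m + 1 = (q + 1) n`
  obtain ⟨-, -, -, -, -, -, -, -, -, -, -, -, -, ⟨q, hq1, hq⟩, -, -⟩ := hspread y₀ hy₀ hy₀c
  have hqn2 : 2 ≤ q * n := le_trans hn (Nat.le_mul_of_pos_left n (by omega))
  have hqn : m - n + 1 = q * n := by rw [Nat.add_mul, one_mul] at hq; omega
  have ha1 : 1 ≤ m - n := by omega
  -- the curve centre `C₀ = 𝓘(cl{η})`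
  set C0 : Y.IdealSheafData :=
    Scheme.IdealSheafData.vanishingIdeal (⟨closure ({η} : Set Y), isClosed_closure⟩ : Closeds Y) with hC0def
  have hC0supp : ∀ y : Y, y ∈ (C0.support : Set Y) ↔ η ⤳ y := fun y => by
    rw [hC0def, coe_support_vanishingIdeal, specializes_iff_mem_closure]
    rfl
  have hC0st : ∀ (y : Y) (h : η ⤳ y), stalkIdeal C0 y = curvePrime h := fun y h => by
    rw [hC0def, stalkIdeal_vanishingIdeal_closure h]
    rfl
  have hC0reg : Scheme.IsRegular C0.subscheme := isRegular_curve_subscheme hY I hcurve hspread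
  have hsuppT : (C0.support : Set Y) ⊆ {y | η ⤳ y} := fun y hy => (hC0supp y).mp hy
  have hsuppM : (C0.support : Set Y) ⊆ (⟨I, [], n⟩ : MarkedIdeal Y).support := by
    intro y hy
    have h : η ⤳ y := (hC0supp y).mp hy
    rw [MarkedIdeal.mem_support_iff]
    change stalkIdeal I y ≤ maximalIdeal _ ^ n
    by_cases hyc : IsClosed ({y} : Set Y)
    · obtain ⟨h', hle, hPm⟩ := exists_stalkIdeal_le_curvePrime_pow I hn (hspread y h hyc)
      exact hle.trans (Ideal.pow_right_mono hPm n)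
    · have hyη : y = η := by
        by_contra hne
        exact hyc (hcurve.2 y h hne)
      subst hyη
      obtain ⟨h', hle, -⟩ := exists_stalkIdeal_le_curvePrime_pow I hn (hspread y₀ hy₀ hy₀c)
      rw [← stalkIdeal_map_stalkSpecializes I h']
      refine (Ideal.map_mono hle).trans ?_
      rw [Ideal.map_pow]
      exact Ideal.pow_right_mono Ideal.map_comap_le n
  -- the blow-up `Y₁ → Y` of the curve: regular, proper
  haveI := CentreSeq.isLocallyNoetherian_blowup C0
  have hY₁ : Scheme.IsRegular ↑(blowup C0) :=
    IsBlowup.isRegular_of_isRegular_subscheme hY hC0reg (blowup.isBlowup C0)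
  haveI : IsProper (blowup.π C0) := (blowup.isBlowup C0).isProper
  -- the stage invariant on `Y₁` over the curve, `a = m - n`
  have hinv : ∀ x' ∈ blowup.π C0 ⁻¹' {y | η ⤳ y},
      stalkIdeal ((⟨I, [], n⟩ : MarkedIdeal Y).transform (blowup.π C0) C0).ideal x' = ⊤ ∨
        Nonempty (ShapeData (stalkIdeal ((⟨I, [], n⟩ : MarkedIdeal Y).transform (blowup.π C0) C0).ideal x')
          (stalkIdeal (C0.comap (blowup.π C0)) x')
          ((⟨I, [], n⟩ : MarkedIdeal Y).transform (blowup.π C0) C0).mult (m - n)) := by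
    intro x' hx'
    have hηx : η ⤳ blowup.π C0 x' := hx'
    change stalkIdeal (controlledTransform (blowup.π C0) C0 I n) x' = ⊤ ∨
      Nonempty (ShapeData (stalkIdeal (controlledTransform (blowup.π C0) C0 I n) x')
        (stalkIdeal (C0.comap (blowup.π C0)) x') n (m - n))
    by_cases hcl : IsClosed ({blowup.π C0 x'} : Set Y)
    · exact towerInv_of_isSpreadAt hY C0 I hn hC0st x' (hspread _ hηx hcl)
    · have hπη : blowup.π C0 x' = η := by
        by_contra hne
        exact hcl (hcurve.2 _ hηx hne)
      obtain ⟨x'', hxx, hπx⟩ := exists_specializes_over (blowup.π C0) (blowup.π C0).isClosedMap x'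
        (y₀ := y₀) (by rw [hπη]; exact hy₀)
      have hηx'' : η ⤳ blowup.π C0 x'' := by rw [hπx]; exact hy₀
      have hcl'' : IsClosed ({blowup.π C0 x''} : Set Y) := by rw [hπx]; exact hy₀c
      exact inv_of_specializes _ _ ha1 hxx
        ((mem_support_comap_iff _ _ x').mpr ((hC0supp _).mpr hηx))
        (towerInv_of_isSpreadAt hY C0 I hn hC0st x'' (hspread _ hηx'' hcl''))
  -- run the Σ-stage engine `q - 1` times
  have ha : m - n + 1 = (q - 1 + 1) * ((⟨I, [], n⟩ : MarkedIdeal Y).transform (blowup.π C0) C0).mult := by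
    change m - n + 1 = (q - 1 + 1) * n
    rw [Nat.sub_add_cancel hq1]
    exact hqn
  have hTE : ((C0.comap (blowup.π C0)).support : Set _) ⊆ blowup.π C0 ⁻¹' {y | η ⤳ y} := fun x' hx' =>
    hsuppT ((mem_support_comap_iff _ _ x').mp hx')
  obtain ⟨rest, hwa, hco, hT, hexit⟩ := sigmaStage (q - 1) hY₁
    ((⟨I, [], n⟩ : MarkedIdeal Y).transform (blowup.π C0) C0) (C0.comap (blowup.π C0))
    (blowup.π C0 ⁻¹' {y | η ⤳ y}) (m - n) hn ha hTE hinv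
  refine ⟨CentreSeq.cons C0 rest, ⟨hsuppM, hC0reg, hwa⟩, ⟨hsuppT, hco⟩, hT, fun x hx hord => ?_⟩
  have hx' : rest.comp x ∈ blowup.π C0 ⁻¹' {y | η ⤳ y} := hx
  have hord' : ((n : ℕ) : ℕ∞) ≤ idealOrder ((CentreSeq.cons C0 rest).transformMarked ⟨I, [], n⟩).ideal x :=
    le_of_eq hord.symm
  simpa [CentreSeq.transformMarked_cons] using
    hexit x hx' (by simpa [CentreSeq.transformMarked_cons] using hord')

end Tower

/-! ## §9  DISCHARGE COROLLARY: the landed 18-engine corollary with the binder `hΓE : SpreadExit` removed BY NAME -/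

section Corollaries

open Summit.ResolutionOfSingularities.ResolutionOfSingularities.Theorems.FaceFormCutClasses
open Summit.ResolutionOfSingularities.ResolutionOfSingularities.Theorems.CurveLeafExit
open Summit.ResolutionOfSingularities.ResolutionOfSingularities.Theorems.PinchCut
open Summit.ResolutionOfSingularities.ResolutionOfSingularities.Theorems.JetCut
open Summit.ResolutionOfSingularities.ResolutionOfSingularities.Theorems.PurityCut
open Summit.ResolutionOfSingularities.ResolutionOfSingularities.Theorems.SplitCut
open Summit.ResolutionOfSingularities.ResolutionOfSingularities.Theorems.CylinderCut
open Summit.ResolutionOfSingularities.ResolutionOfSingularities.Theorems.CrossCut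
open Summit.ResolutionOfSingularities.ResolutionOfSingularities.Theorems.DeepCrossCut
open Summit.ResolutionOfSingularities.ResolutionOfSingularities.Theorems.OddCrossCut
open Summit.ResolutionOfSingularities.ResolutionOfSingularities.Theorems.CuspCut
open Summit.ResolutionOfSingularities.ResolutionOfSingularities.Theses

/-- **`CuspX.CuspGenericRung` FROM SEVENTEEN ENGINES** — the landed `PortCut.cuspGenericRung_of_engines` with its
binder `hΓE : SpreadExit` DISCHARGED by `spreadExit_holds`. [folklore] -/
theorem cuspGenericRung_of_engines (hV : VeryNearCutClasses.VeryNearExit) (hD : DeltaPackageExit)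
    (hU : UniformCurvePackageExit) (hR : RelCurvePackageExit) (hN : NormalConeJumpExit)
    (hM : MonomialPinchExit) (hC : FlatConeExit) (hGE : GrandExit) (hSE : SplitConeExit)
    (hJE : JetCylinderExit) (hX : MaxContactCut.MaxOrderThreefoldResolution) (hXE : CrossExit)
    (hDXE : DeepCrossExit) (hNE : NodeExit) (hOXE : OddCrossExit) (hCuE : CuspExit) (hTaE : TameTwoExit) :
    CuspX.CuspGenericRung :=
  PortCut.cuspGenericRung_of_engines hV hD hU hR hN hM hC hGE hSE hJE hX spreadExit_holds hXE hDXE hNE hOXE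
    hCuE hTaE

/-- **`MaxContactCut.RungOne` BY NAME from seventeen engines and the located residual `CuspX.CuspSpecialRung`**
(`CuspX.closes`, cited, not re-landed). [folklore] -/
theorem closes_of_engines (hV : VeryNearCutClasses.VeryNearExit) (hD : DeltaPackageExit)
    (hU : UniformCurvePackageExit) (hR : RelCurvePackageExit) (hN : NormalConeJumpExit)
    (hM : MonomialPinchExit) (hC : FlatConeExit) (hGE : GrandExit) (hSE : SplitConeExit)
    (hJE : JetCylinderExit) (hX : MaxContactCut.MaxOrderThreefoldResolution) (hXE : CrossExit)
    (hDXE : DeepCrossExit) (hNE : NodeExit) (hOXE : OddCrossExit) (hCuE : CuspExit) (hTaE : TameTwoExit)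
    (hS : CuspX.CuspSpecialRung) : MaxContactCut.RungOne :=
  CuspX.closes (cuspGenericRung_of_engines hV hD hU hR hN hM hC hGE hSE hJE hX hXE hDXE hNE hOXE hCuE hTaE) hS

end Corollaries

end Summit.ResolutionOfSingularities.ResolutionOfSingularities.Theorems.TowerCut
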